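import Literature.AlgebraicGeometry.HodgeTheory.QuaternionicQuarticBranchChart
import HarnessLib

/-!
# The dictionary between the étale deck chart and the μ₄×μ₂ branch chart of the normalised quaternionic quartic cover
# (programme «BRANCH CHART», brick BC-1, part 2)

Layer `Literature/AlgebraicGeometry/HodgeTheory`. Definitions + proved API (no named fact). Written by the prover seat
`hodge-nonav-prover-Bx` (g21, cell `hodge-nonav`), memo `HOME/memos/S5-GLOBAL-ARCHITECTURE-Bx-g21.md` §2, for crux K1Q
`VeryGeneralQuaternionCommutatorsInHg` of `Summits/HodgeConjecture/HodgeConjecture/Theses/Q8SymplecticPowers.lean`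
(stmt-HodgeConjecture-24190; stub S9, S5-half). Sequel of `QuaternionicQuarticBranchChart` (the branch chart
`BranchRing a = R[u₀, u₁, s, y, v′]/(s⁴ − cσc³, y² − αψ, v′σcα − 1)` with `ι`, `τ̃`) and of `QuaternionicQuarticDeckChart` (the étale
chart `DeckRing a = R[u₀, u₁, w, w₁, w₂, v]/(r₁, …, r₇)` over `h = cσcαψ ≠ 0`, with `τ₀`, `j₀`).

* §2 the LOCALISED branch chart `BranchRingLoc a = R[u₀, u₁, s, y, v′, t]/(b₁, b₂, b₃, b₄)`, `b₄ = t·c·ψ − 1` (over `h ≠ 0`; the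
  variables are `Fin 6` again, so `cU, cU', αU, ψU, hU` of the deck chart file are literally reused), the inclusion
  `inclHom : BranchRing a → BranchRingLoc a`, the involution `iotaL` / `iotaLHom`;
* §3 the DICTIONARY `w = s·y`, `w₁ = s²/σc = s²·v′α`, `w₂ = s³y/σc² = s³y·(v′α)²`, `v = 1/h = v′·t`: the substitution `dictPoly`
  maps every relation `r₁, …, r₇` into `(b₁, …, b₄)` with EXPLICIT certificates (`dictPoly_rel_mem`), hence
  **`dictHom : DeckRing a →ₐ[R] BranchRingLoc a`**; the image is `ι`-invariant (`iotaL_comp_dictPoly`, `iotaLHom_comp_dictHom`);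
* §3b the deck substitution `tauL` / `tauLHom` on the localised chart and **`τ̃ ∘ dict = dict ∘ τ₀`** (`tauL_comp_dictPoly`,
  `tauLHom_dictHom_mk`): the deck chart is the `ι`-quotient of the branch chart over `h ≠ 0` and the route's `τ` is induced by
  `s ↦ i·s`.

Honest scope: explicit commutative algebra (no freeness / invariant-subring / étaleness statements — next bricks of the memo);
nothing here bears on HC.

## References

* [Kollar2007] J. Kollár, Lectures on Resolution of Singularities (2007), §3.3 (the family), §3.4.1 (group actions).
* [Hartshorne1977] R. Hartshorne, Algebraic Geometry (1977), II Ex. 2.9–2.14.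
-/

noncomputable section

open MvPolynomial

namespace Literature.AlgebraicGeometry.HodgeTheory.Q8Family

universe v

/-! ### §2 The localised branch chart `R[u₀, u₁, s, y, v′, t]/(b₁, b₂, b₃, t·c·ψ − 1)` (over `h ≠ 0`) -/

section Loc

variable {R : Type v} [CommRing R] {e : ℕ} (a : CIdx e → R)

/-- The relations of the localised branch chart in the variables `(u₀, u₁, s, y, v′, t) = (X 0, …, X 5)` of
`MvPolynomial (Fin 6) R` (so `cU, cU', αU, ψU, hU` of the deck chart file are the same polynomials in `u₀, u₁`):
`b₁ = s⁴ − cσc³`, `b₂ = y² − αψ`, `b₃ = v′σcα − 1`, `b₄ = t·c·ψ − 1`. [cite: Kollar2007, §3.3] -/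
def lrel : Fin 4 → MvPolynomial (Fin 6) R
  | 0 => X 2 ^ 4 - cU a * cU' a ^ 3
  | 1 => X 3 ^ 2 - αU * ψU a
  | 2 => X 4 * (cU' a * αU) - 1
  | 3 => X 5 * (cU a * ψU a) - 1

/-- The ideal `(b₁, b₂, b₃, b₄)`. [cite: Kollar2007, §3.3] -/
def locIdeal : Ideal (MvPolynomial (Fin 6) R) := Ideal.span (Set.range (lrel a))

/-- **The localised branch chart** `R[u₀, u₁, s, y, v′, t]/(s⁴ − cσc³, y² − αψ, v′σcα − 1, tcψ − 1)`: the μ₄×μ₂ branch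
chart over `h = cσcαψ ≠ 0`. [cite: Kollar2007, §3.3] -/
abbrev BranchRingLoc : Type v := MvPolynomial (Fin 6) R ⧸ locIdeal a

/-- Each relation lies in the ideal. [cite: Kollar2007, §3.3] -/
theorem lrel_mem_locIdeal (k : Fin 4) : lrel a k ∈ locIdeal a := Ideal.subset_span ⟨k, rfl⟩

/-- A combination `Σ qₖ bₖ` lies in the ideal. [folklore] -/
private theorem mem_locIdeal_of_eq_comb {p : MvPolynomial (Fin 6) R} (q₀ q₁ q₂ q₃ : MvPolynomial (Fin 6) R)
    (h : p = q₀ * lrel a 0 + q₁ * lrel a 1 + q₂ * lrel a 2 + q₃ * lrel a 3) : p ∈ locIdeal a := by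
  rw [h]
  refine Ideal.add_mem _ (Ideal.add_mem _ (Ideal.add_mem _ ?_ ?_) ?_) ?_ <;>
    exact Ideal.mul_mem_left _ _ (lrel_mem_locIdeal a _)

/-- The inclusion of variables `(u₀, u₁, s, y, v′) ↦ (u₀, u₁, s, y, v′)` (`Fin 5 → Fin 6`, `castSucc`). [cite: Kollar2007, §3.3] -/
def inclPoly (R : Type v) [CommRing R] : MvPolynomial (Fin 5) R →ₐ[R] MvPolynomial (Fin 6) R :=
  rename Fin.castSucc

/-- The inclusion on dehomogenised forms. [cite: Kollar2007, §3.3] -/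
theorem inclPoly_dehomB (p : MvPolynomial (Fin 3) R) : inclPoly R (dehomB p) = dehom p := by
  change ((inclPoly R).comp dehomB) p = dehom p
  congr 1
  refine MvPolynomial.algHom_ext fun i => ?_
  fin_cases i <;> simp [inclPoly, dehomB, dehom]

/-- `incl c = c`. [cite: Kollar2007, §3.3] -/
@[simp] theorem inclPoly_cB : inclPoly R (cB a) = cU a := inclPoly_dehomB _
/-- `incl σc = σc`. [cite: Kollar2007, §3.3] -/
@[simp] theorem inclPoly_cB' : inclPoly R (cB' a) = cU' a := inclPoly_dehomB _
/-- `incl ψ = ψ`. [cite: Kollar2007, §3.3] -/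
@[simp] theorem inclPoly_ψB : inclPoly R (ψB a) = ψU a := inclPoly_dehomB _
/-- `incl α = α`. [cite: Kollar2007, §3.3] -/
@[simp] theorem inclPoly_αB : inclPoly R (αB : MvPolynomial (Fin 5) R) = αU := by
  simp [inclPoly, αB, αU]
/-- `incl` on the generators. [cite: Kollar2007, §3.3] -/
@[simp] theorem inclPoly_X (i : Fin 5) : inclPoly R (X i : MvPolynomial (Fin 5) R) = X i.castSucc := by
  simp [inclPoly]

/-- The inclusion maps `(b₁, b₂, b₃) ↦ (b₁, b₂, b₃)`. [cite: Kollar2007, §3.3] -/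
theorem inclPoly_rel_mem (k : Fin 3) : inclPoly R (brel a k) ∈ locIdeal a := by
  fin_cases k
  · exact mem_locIdeal_of_eq_comb a 1 0 0 0 (by simp [brel, lrel])
  · exact mem_locIdeal_of_eq_comb a 0 1 0 0 (by simp [brel, lrel])
  · exact mem_locIdeal_of_eq_comb a 0 0 1 0 (by simp [brel, lrel])

/-- `(b₁, b₂, b₃) ≤ incl⁻¹ (b₁, …, b₄)`. [cite: Kollar2007, §3.3] -/
theorem branchIdeal_le_comap_inclPoly : branchIdeal a ≤ (locIdeal a).comap (inclPoly R) := by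
  rw [branchIdeal, Ideal.span_le]
  rintro _ ⟨k, rfl⟩
  exact inclPoly_rel_mem a k

/-- **The open immersion `BranchRing a → BranchRingLoc a`** (restriction to `h ≠ 0`), on rings. [cite: Kollar2007, §3.3] -/
def inclHom : BranchRing a →ₐ[R] BranchRingLoc a :=
  Ideal.quotientMapₐ (locIdeal a) (inclPoly R) (branchIdeal_le_comap_inclPoly a)

/-- `incl` after the quotient map. [cite: Kollar2007, §3.3] -/
@[simp] theorem inclHom_mk (p : MvPolynomial (Fin 5) R) :
    inclHom a (Ideal.Quotient.mk (branchIdeal a) p) = Ideal.Quotient.mk (locIdeal a) (inclPoly R p) := rfl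

/-- The covering involution on the localised chart: `(u₀, u₁, s, y, v′, t) ↦ (u₀, u₁, −s, −y, v′, t)`. [cite: Kollar2007, §3.4.1] -/
def iotaL (R : Type v) [CommRing R] : MvPolynomial (Fin 6) R →ₐ[R] MvPolynomial (Fin 6) R :=
  aeval ![X 0, X 1, -X 2, -X 3, X 4, X 5]

/-- `ι` on the generator `X 0`. [cite: Kollar2007, §3.4.1] -/
@[simp] theorem iotaL_X0 : iotaL R (X 0) = X 0 := by simp [iotaL]
/-- `ι` on the generator `X 1`. [cite: Kollar2007, §3.4.1] -/
@[simp] theorem iotaL_X1 : iotaL R (X 1) = X 1 := by simp [iotaL]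
/-- `ι` on the generator `X 2`. [cite: Kollar2007, §3.4.1] -/
@[simp] theorem iotaL_X2 : iotaL R (X 2) = -X 2 := by simp [iotaL]
/-- `ι` on the generator `X 3`. [cite: Kollar2007, §3.4.1] -/
@[simp] theorem iotaL_X3 : iotaL R (X 3) = -X 3 := by simp [iotaL]
/-- `ι` on the generator `X 4`. [cite: Kollar2007, §3.4.1] -/
@[simp] theorem iotaL_X4 : iotaL R (X 4) = X 4 := by simp [iotaL]
/-- `ι` on the generator `X 5`. [cite: Kollar2007, §3.4.1] -/
@[simp] theorem iotaL_X5 : iotaL R (X 5) = X 5 := by simp [iotaL]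

/-- `ι` fixes everything dehomogenised from `ℂ[x₀, x₁, x₂]`. [cite: Kollar2007, §3.4.1] -/
theorem iotaL_dehom (p : MvPolynomial (Fin 3) R) : iotaL R (dehom p) = dehom p := by
  change ((iotaL R).comp dehom) p = dehom p
  congr 1
  refine MvPolynomial.algHom_ext fun i => ?_
  fin_cases i <;> simp [iotaL, dehom]

/-- `ι c = c`. [cite: Kollar2007, §3.4.1] -/
@[simp] theorem iotaL_cU : iotaL R (cU a) = cU a := iotaL_dehom _
/-- `ι (σc) = σc`. [cite: Kollar2007, §3.4.1] -/
@[simp] theorem iotaL_cU' : iotaL R (cU' a) = cU' a := iotaL_dehom _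
/-- `ι ψ = ψ`. [cite: Kollar2007, §3.4.1] -/
@[simp] theorem iotaL_ψU : iotaL R (ψU a) = ψU a := iotaL_dehom _
/-- `ι α = α`. [cite: Kollar2007, §3.4.1] -/
@[simp] theorem iotaL_αU : iotaL R (αU : MvPolynomial (Fin 6) R) = αU := by
  simp only [αU, map_sub, iotaL_X0, iotaL_X1]
/-- `ι h = h`. [cite: Kollar2007, §3.4.1] -/
@[simp] theorem iotaL_hU : iotaL R (hU a) = hU a := by
  simp only [hU, map_mul, iotaL_cU, iotaL_cU', iotaL_αU, iotaL_ψU]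

/-- `ι` maps `(b₁, …, b₄)` to themselves. [cite: Kollar2007, §3.4.1] -/
theorem iotaL_rel_mem (k : Fin 4) : iotaL R (lrel a k) ∈ locIdeal a := by
  fin_cases k
  · exact mem_locIdeal_of_eq_comb a 1 0 0 0 (by simp [lrel]; ring)
  · exact mem_locIdeal_of_eq_comb a 0 1 0 0 (by simp [lrel])
  · exact mem_locIdeal_of_eq_comb a 0 0 1 0 (by simp [lrel])
  · exact mem_locIdeal_of_eq_comb a 0 0 0 1 (by simp [lrel])

/-- The ideal is `ι`-stable. [cite: Kollar2007, §3.4.1] -/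
theorem locIdeal_le_comap_iotaL : locIdeal a ≤ (locIdeal a).comap (iotaL R) := by
  rw [locIdeal, Ideal.span_le]
  rintro _ ⟨k, rfl⟩
  exact iotaL_rel_mem a k

/-- `ι` on `BranchRingLoc a`. [cite: Kollar2007, §3.4.1] -/
def iotaLHom : BranchRingLoc a →ₐ[R] BranchRingLoc a :=
  Ideal.quotientMapₐ (locIdeal a) (iotaL R) (locIdeal_le_comap_iotaL a)

/-- `ι` after the quotient map. [cite: Kollar2007, §3.4.1] -/
@[simp] theorem iotaLHom_mk (p : MvPolynomial (Fin 6) R) :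
    iotaLHom a (Ideal.Quotient.mk (locIdeal a) p) = Ideal.Quotient.mk (locIdeal a) (iotaL R p) := rfl

end Loc

/-! ### §3 The dictionary `w = sy`, `w₁ = s²·v′α`, `w₂ = s³y·(v′α)²`, `v = v′t`: `DeckRing a → BranchRingLoc a` -/

section Dict

variable {R : Type v} [CommRing R] {e : ℕ} (a : CIdx e → R)

/-- The dictionary substitution on polynomial rings: `(u₀, u₁, w, w₁, w₂, v) ↦ (u₀, u₁, s·y, s²·(v′α), s³y·(v′α)², v′·t)`
(`s²/σc = s²·v′α` and `1/h = v′·t` on the localised branch chart). [cite: Kollar2007, §3.3] -/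
def dictPoly : MvPolynomial (Fin 6) R →ₐ[R] MvPolynomial (Fin 6) R :=
  aeval ![X 0, X 1, X 2 * X 3, X 2 ^ 2 * (X 4 * αU), X 2 ^ 3 * X 3 * (X 4 * αU) ^ 2, X 4 * X 5]

/-- The dictionary on the generator `X 0`. [cite: Kollar2007, §3.3] -/
@[simp] theorem dictPoly_X0 : dictPoly (R := R) (X 0) = X 0 := by simp [dictPoly]
/-- The dictionary on the generator `X 1`. [cite: Kollar2007, §3.3] -/
@[simp] theorem dictPoly_X1 : dictPoly (R := R) (X 1) = X 1 := by simp [dictPoly]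
/-- The dictionary on the generator `X 2` (`w ↦ s·y`). [cite: Kollar2007, §3.3] -/
@[simp] theorem dictPoly_X2 : dictPoly (R := R) (X 2) = X 2 * X 3 := by simp [dictPoly]
/-- The dictionary on the generator `X 3` (`w₁ ↦ s²·v′α`). [cite: Kollar2007, §3.3] -/
@[simp] theorem dictPoly_X3 : dictPoly (R := R) (X 3) = X 2 ^ 2 * (X 4 * αU) := by simp [dictPoly]
/-- The dictionary on the generator `X 4` (`w₂ ↦ s³y·(v′α)²`). [cite: Kollar2007, §3.3] -/
@[simp] theorem dictPoly_X4 : dictPoly (R := R) (X 4) = X 2 ^ 3 * X 3 * (X 4 * αU) ^ 2 := by simp [dictPoly]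
/-- The dictionary on the generator `X 5` (`v ↦ v′·t`). [cite: Kollar2007, §3.3] -/
@[simp] theorem dictPoly_X5 : dictPoly (R := R) (X 5) = X 4 * X 5 := by simp [dictPoly]

/-- The dictionary fixes everything dehomogenised from `ℂ[x₀, x₁, x₂]`. [cite: Kollar2007, §3.3] -/
theorem dictPoly_dehom (p : MvPolynomial (Fin 3) R) : dictPoly (R := R) (dehom p) = dehom p := by
  change ((dictPoly (R := R)).comp dehom) p = dehom p
  congr 1
  refine MvPolynomial.algHom_ext fun i => ?_
  fin_cases i <;> simp [dictPoly, dehom]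

/-- `dict c = c`. [cite: Kollar2007, §3.3] -/
@[simp] theorem dictPoly_cU : dictPoly (R := R) (cU a) = cU a := dictPoly_dehom _
/-- `dict (σc) = σc`. [cite: Kollar2007, §3.3] -/
@[simp] theorem dictPoly_cU' : dictPoly (R := R) (cU' a) = cU' a := dictPoly_dehom _
/-- `dict ψ = ψ`. [cite: Kollar2007, §3.3] -/
@[simp] theorem dictPoly_ψU : dictPoly (R := R) (ψU a) = ψU a := dictPoly_dehom _
/-- `dict α = α`. [cite: Kollar2007, §3.3] -/
@[simp] theorem dictPoly_αU : dictPoly (R := R) (αU : MvPolynomial (Fin 6) R) = αU := by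
  simp only [αU, map_sub, dictPoly_X0, dictPoly_X1]
/-- `dict h = h`. [cite: Kollar2007, §3.3] -/
@[simp] theorem dictPoly_hU : dictPoly (R := R) (hU a) = hU a := by
  simp only [hU, map_mul, dictPoly_cU, dictPoly_cU', dictPoly_αU, dictPoly_ψU]

/-- **The dictionary maps every relation `r₁, …, r₇` of the deck chart into `(b₁, …, b₄)`**, with explicit certificates:
`r₁ ↦ (v′α)²·b₁ + cσc(v′σcα + 1)·b₃`, `r₂ ↦ s²·b₂ − s²αψ·b₃`, `r₄ ↦ −s³y v′α·b₃`, `r₇ ↦ tcψ·b₃ + b₄`, and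
`r₃, r₅, r₆` through `s⁴(v′α)³ − c = (v′α)³·b₁ + c((v′σcα)² + v′σcα + 1)·b₃`. [cite: Kollar2007, §3.3] -/
theorem dictPoly_rel_mem (k : Fin 7) : dictPoly (R := R) (rel a k) ∈ locIdeal a := by
  fin_cases k
  · exact mem_locIdeal_of_eq_comb a ((X 4 * αU) ^ 2) 0 (cU a * cU' a * (X 4 * (cU' a * αU) + 1)) 0
      (by simp [rel, lrel]; ring)
  · exact mem_locIdeal_of_eq_comb a 0 (X 2 ^ 2) (-(X 2 ^ 2 * αU * ψU a)) 0 (by simp [rel, lrel]; ring)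
  · exact mem_locIdeal_of_eq_comb a (X 2 ^ 2 * αU ^ 2 * ψU a * X 4 * (X 4 * αU) ^ 3)
      (X 2 ^ 6 * (X 4 * αU) ^ 4)
      (X 2 ^ 2 * αU ^ 2 * ψU a * X 4 * (cU a * ((X 4 * (cU' a * αU)) ^ 2 + X 4 * (cU' a * αU) + 1))) 0
      (by simp [rel, lrel]; ring)
  · exact mem_locIdeal_of_eq_comb a 0 0 (-(X 2 ^ 3 * X 3 * (X 4 * αU))) 0 (by simp [rel, lrel]; ring)
  · exact mem_locIdeal_of_eq_comb a (X 2 * X 3 * (X 4 * αU) ^ 3) 0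
      (X 2 * X 3 * (cU a * ((X 4 * (cU' a * αU)) ^ 2 + X 4 * (cU' a * αU) + 1))) 0
      (by simp [rel, lrel]; ring)
  · exact mem_locIdeal_of_eq_comb a (αU * ψU a * (X 4 * αU) ^ 2) (X 2 ^ 4 * (X 4 * αU) ^ 2)
      (αU * ψU a * (cU a * cU' a * (X 4 * (cU' a * αU) + 1))) 0
      (by simp [rel, lrel, hU]; ring)
  · exact mem_locIdeal_of_eq_comb a 0 0 (X 5 * (cU a * ψU a)) 1 (by simp [rel, lrel, hU]; ring)

/-- `(r₁, …, r₇) ≤ dict⁻¹ (b₁, …, b₄)`. [cite: Kollar2007, §3.3] -/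
theorem deckIdeal_le_comap_dictPoly : deckIdeal a ≤ (locIdeal a).comap (dictPoly (R := R)) := by
  rw [deckIdeal, Ideal.span_le]
  rintro _ ⟨k, rfl⟩
  exact dictPoly_rel_mem a k

/-- **The dictionary `DeckRing a →ₐ[R] BranchRingLoc a`**: the étale deck chart of the normalised quartic cover is dominated
by the localised μ₄×μ₂ branch chart (`w = sy`, `w₁ = s²/σc`, `w₂ = s³y/σc²`, `v = 1/h`). [cite: Kollar2007, §3.3] -/
def dictHom : DeckRing a →ₐ[R] BranchRingLoc a :=
  Ideal.quotientMapₐ (locIdeal a) (dictPoly (R := R)) (deckIdeal_le_comap_dictPoly a)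

/-- The dictionary after the quotient map. [cite: Kollar2007, §3.3] -/
@[simp] theorem dictHom_mk (p : MvPolynomial (Fin 6) R) :
    dictHom a (Ideal.Quotient.mk (deckIdeal a) p) = Ideal.Quotient.mk (locIdeal a) (dictPoly (R := R) p) := rfl

/-- **The image of the dictionary is `ι`-invariant**: `ι ∘ dict = dict` already on polynomial rings (`sy`, `s²`, `s³y` are even).
[cite: Kollar2007, §3.4.1] -/
theorem iotaL_comp_dictPoly : (iotaL R).comp (dictPoly (R := R)) = dictPoly (R := R) := by
  refine MvPolynomial.algHom_ext fun i => ?_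
  fin_cases i
  · simp
  · simp
  · simp
  · simp
  · simp; ring
  · simp

/-- Hence `ι ∘ dictHom = dictHom` on `DeckRing a`. [cite: Kollar2007, §3.4.1] -/
theorem iotaLHom_comp_dictHom : (iotaLHom a).comp (dictHom a) = dictHom a := by
  refine AlgHom.ext fun x => ?_
  obtain ⟨p, rfl⟩ := Ideal.Quotient.mk_surjective x
  show iotaLHom a (dictHom a (Ideal.Quotient.mk (deckIdeal a) p)) = dictHom a (Ideal.Quotient.mk (deckIdeal a) p)
  rw [dictHom_mk, iotaLHom_mk, ← AlgHom.comp_apply, iotaL_comp_dictPoly]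

end Dict

/-! ### §3b The deck substitution on the localised chart and its compatibility with `τ₀` -/

section DictTau

variable {R : Type v} [CommRing R] [Algebra ℂ R] {e : ℕ} (a : CIdx e → R)

/-- `τ̃ : (u₀, u₁, s, y, v′, t) ↦ (u₀, u₁, i·s, y, v′, t)` on the localised chart. [cite: Kollar2007, §3.4.1] -/
def tauL (R : Type v) [CommRing R] [Algebra ℂ R] : MvPolynomial (Fin 6) R →ₐ[R] MvPolynomial (Fin 6) R :=
  aeval ![X 0, X 1, C (iR R) * X 2, X 3, X 4, X 5]

/-- `τ̃` on the generator `X 0`. [cite: Kollar2007, §3.4.1] -/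
@[simp] theorem tauL_X0 : tauL R (X 0) = X 0 := by simp [tauL]
/-- `τ̃` on the generator `X 1`. [cite: Kollar2007, §3.4.1] -/
@[simp] theorem tauL_X1 : tauL R (X 1) = X 1 := by simp [tauL]
/-- `τ̃` on the generator `X 2`. [cite: Kollar2007, §3.4.1] -/
@[simp] theorem tauL_X2 : tauL R (X 2) = C (iR R) * X 2 := by simp [tauL]
/-- `τ̃` on the generator `X 3`. [cite: Kollar2007, §3.4.1] -/
@[simp] theorem tauL_X3 : tauL R (X 3) = X 3 := by simp [tauL]
/-- `τ̃` on the generator `X 4`. [cite: Kollar2007, §3.4.1] -/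
@[simp] theorem tauL_X4 : tauL R (X 4) = X 4 := by simp [tauL]
/-- `τ̃` on the generator `X 5`. [cite: Kollar2007, §3.4.1] -/
@[simp] theorem tauL_X5 : tauL R (X 5) = X 5 := by simp [tauL]

/-- `τ̃` fixes everything dehomogenised from `ℂ[x₀, x₁, x₂]`. [cite: Kollar2007, §3.4.1] -/
theorem tauL_dehom (p : MvPolynomial (Fin 3) R) : tauL R (dehom p) = dehom p := by
  change ((tauL R).comp dehom) p = dehom p
  congr 1
  refine MvPolynomial.algHom_ext fun i => ?_
  fin_cases i <;> simp [tauL, dehom]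

/-- `τ̃ c = c`. [cite: Kollar2007, §3.4.1] -/
@[simp] theorem tauL_cU : tauL R (cU a) = cU a := tauL_dehom _
/-- `τ̃ (σc) = σc`. [cite: Kollar2007, §3.4.1] -/
@[simp] theorem tauL_cU' : tauL R (cU' a) = cU' a := tauL_dehom _
/-- `τ̃ ψ = ψ`. [cite: Kollar2007, §3.4.1] -/
@[simp] theorem tauL_ψU : tauL R (ψU a) = ψU a := tauL_dehom _
/-- `τ̃ α = α`. [cite: Kollar2007, §3.4.1] -/
@[simp] theorem tauL_αU : tauL R (αU : MvPolynomial (Fin 6) R) = αU := by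
  simp only [αU, map_sub, tauL_X0, tauL_X1]

/-- `τ̃` maps `(b₁, …, b₄)` to themselves (`i⁴ = 1`). [cite: Kollar2007, §3.4.1] -/
theorem tauL_rel_mem (k : Fin 4) : tauL R (lrel a k) ∈ locIdeal a := by
  have h : (C (iR R) * C (iR R) : MvPolynomial (Fin 6) R) = -1 := C_iR_mul_C_iR
  have h4 : (C (iR R) : MvPolynomial (Fin 6) R) ^ 4 = 1 := by
    calc (C (iR R) : MvPolynomial (Fin 6) R) ^ 4 = (C (iR R) * C (iR R)) * (C (iR R) * C (iR R)) := by ring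
      _ = 1 := by rw [h]; ring
  fin_cases k
  · refine Ideal.subset_span ⟨0, ?_⟩
    simp [lrel, mul_pow, h4]
  · exact Ideal.subset_span ⟨1, by simp [lrel]⟩
  · exact Ideal.subset_span ⟨2, by simp [lrel]⟩
  · exact Ideal.subset_span ⟨3, by simp [lrel]⟩

/-- The ideal is `τ̃`-stable. [cite: Kollar2007, §3.4.1] -/
theorem locIdeal_le_comap_tauL : locIdeal a ≤ (locIdeal a).comap (tauL R) := by
  rw [locIdeal, Ideal.span_le]
  rintro _ ⟨k, rfl⟩
  exact tauL_rel_mem a k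

/-- `τ̃` on `BranchRingLoc a`. [cite: Kollar2007, §3.4.1] -/
def tauLHom : BranchRingLoc a →ₐ[R] BranchRingLoc a :=
  Ideal.quotientMapₐ (locIdeal a) (tauL R) (locIdeal_le_comap_tauL a)

/-- `τ̃` after the quotient map. [cite: Kollar2007, §3.4.1] -/
@[simp] theorem tauLHom_mk (p : MvPolynomial (Fin 6) R) :
    tauLHom a (Ideal.Quotient.mk (locIdeal a) p) = Ideal.Quotient.mk (locIdeal a) (tauL R p) := rfl

/-- **The dictionary intertwines the deck substitutions**: `τ̃ ∘ dict = dict ∘ τ₀` on polynomial rings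
(`i·sy = (i s)y`, `−s²v′α = (i s)²v′α`, `−i s³y(v′α)² = (i s)³y(v′α)²`). [cite: Kollar2007, §3.4.1] -/
theorem tauL_comp_dictPoly : (tauL R).comp (dictPoly (R := R)) = (dictPoly (R := R)).comp (tauPoly R) := by
  have h : (C (iR R) * C (iR R) : MvPolynomial (Fin 6) R) = -1 := C_iR_mul_C_iR
  refine MvPolynomial.algHom_ext fun i => ?_
  fin_cases i
  · simp
  · simp
  · simp only [AlgHom.comp_apply, Fin.reduceFinMk, dictPoly_X2, map_mul, tauL_X2, tauL_X3, tauPoly_X2, algHom_C,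
      MvPolynomial.algebraMap_eq]
    ring
  · simp only [AlgHom.comp_apply, Fin.reduceFinMk, dictPoly_X3, map_mul, map_pow, tauL_X2, tauL_X4, tauL_αU, tauPoly_X3,
      map_neg]
    linear_combination (X 2 ^ 2 * (X 4 * αU) : MvPolynomial (Fin 6) R) * h
  · simp only [AlgHom.comp_apply, Fin.reduceFinMk, dictPoly_X4, map_mul, map_pow, tauL_X2, tauL_X3, tauL_X4, tauL_αU,
      tauPoly_X4, map_neg, algHom_C, MvPolynomial.algebraMap_eq]
    linear_combination (C (iR R) * X 2 ^ 3 * X 3 * (X 4 * αU) ^ 2 : MvPolynomial (Fin 6) R) * h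
  · simp

/-- Hence `τ̃ ∘ dictHom = dictHom ∘ τ` on `DeckRing a` (with `τ = tauHom` of `QuaternionicQuarticDeckChartAction` this reads
`tauLHom ∘ dictHom = dictHom ∘ tauHom`; stated here on representatives). [cite: Kollar2007, §3.4.1] -/
theorem tauLHom_dictHom_mk (p : MvPolynomial (Fin 6) R) :
    tauLHom a (dictHom a (Ideal.Quotient.mk (deckIdeal a) p)) =
      dictHom a (Ideal.Quotient.mk (deckIdeal a) (tauPoly R p)) := by
  rw [dictHom_mk, tauLHom_mk, dictHom_mk, ← AlgHom.comp_apply, tauL_comp_dictPoly, AlgHom.comp_apply]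

end DictTau

end Literature.AlgebraicGeometry.HodgeTheory.Q8Family

end
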